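import Summits.BirchSwinnertonDyer.BirchSwinnertonDyer.Theorems.TeichmullerTwistDescentManinAtMostOnceFiveLe
import HarnessLib

/-!
# Route `TeichmullerTwistDescent`, cruxes PSMU (stmt-BirchSwinnertonDyer-22638) / CORNER (23883) / LOW (23884):
# Manin's `p`-part is AT MOST ONE at every lattice-optimal datum, `p ≥ 5` additive, `E[p]` irreducible —
# GRANTED modularity and Kato's fact F″ ONLY (Dokchitser–Dokchitser removed by torsion transport) (`--supports`)

Cell `pub/bsd-wall` (D-0145 line route-BirchSwinnertonDyer-TeichmullerTwistDescent, OPEN rev 2), seat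
`bsd-line-ttd-p2` (prover 2/2, g2). THEOREMS ONLY (no definition, no named fact, no `sorry`); nothing is
closed, BSD is not proved by this.

`TeichmullerTwistDescentManinAtMostOnceFiveLe.lean` (p590096) proved `ord_p c(D) ≤ 1` granted {modularity, F″,
Dokchitser–Dokchitser `hDD`}; `hDD` entered only to certify that NO member of the class of the starred twist
`W ⊗ χ_{p*}` has a `ℚ_p`-rational point of order `p` (isogeny invariance of `ord_p Δ_min`). Since
2026-08-28T00:13Z the tree has the prime-to-`p` TRANSPORT of local `p`-torsion under `E[p]` irreducible
(`TorsTwist.exists_prime_smul_eq_zero_of_isIsogenous`, p588615, seat bsd-line-edix-p2): a point of order `p` on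
any member moves to the twist model itself, where Mazur's Step 1 (`ord_p Δ_min ≥ 4`) forbids it. Hence:

* `forall_member_noPTorsion_of_four_le_of_irr` — class-wide `W'(ℚ_p)[p] = 0` from `4 ≤ ord_p Δ_min(W)`, `Addv`,
  `Irr`, NO `hDD` (companion of `ManinFrameResidueProperRTameTwist.forall_member_noPTorsion_of_four_le`).
* `dvd_pStar_mul_of_katoNeron_of_lt_six`, `not_sq_dvd_c_of_katoNeron`, `padicValInt_c_le_one_of_katoNeron` — §3–§4
  of the sibling with `hDD` gone: **`ord_p c(D) ≤ 1` at every lattice-optimal datum of every curve additive at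
  `p ≥ 5` with `E[p]` irreducible, GRANTED `exists_isNewformOf` and F″ only**; `p ∤ c(D)` off
  `{p ∈ {5, 7}, ord_p Δ_min < 6}`.
* `padicValInt_c_le_one_of_pubBundles` — the same from the route's REGISTERED PUB bundles
  `KatoNeronAndCremonaFacts` (23789) and `PublishedInputsAdditiveKoly` (20137).

HONEST STATUS: two cite-only inputs (modularity; F″, XL). On CORNER / LOW the last factor `p` is what L-TWIST
removes (`kummerCornerTorsionOptimalManinUnit_of_kato_of_periodTwist`, p590731). BSD is not proved by this.
[cite: EdixhovenManin1991, Thm. 3 (second sentence) and §4 Prop. 9] [cite: Mazur1977, Ch. III §5, Step 1, p. 158]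
[cite: Kato2004Asterisque, (8.1.3) (p. 180), Thm. 9.7 (p. 189)] [cite: KostersPannekoek2017, Thm. 1 and Cor. 2]
[cite: Stevens1989, Lemma (5.2) p. 96, Lemma (5.4) p. 97] [cite: Pal2012, Prop. 2.5]
-/

set_option autoImplicit false
-- single-conjunct summit: `Summit.BirchSwinnertonDyer.BirchSwinnertonDyer.…` repeats the name by design
set_option linter.dupNamespace false

noncomputable section

open scoped Classical MatrixGroups ModularForm

open WeierstrassCurve IsDedekindDomain IsDedekindDomain.HeightOneSpectrum Rat.HeightOneSpectrum NumberField
  Literature.NumberTheory.EllipticCurves Literature.NumberTheory.EllipticCurves.ModularForms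
  Literature.NumberTheory.EllipticCurves.Rank1Residual Literature.NumberTheory.DiophantineGeometry
  Summit.BirchSwinnertonDyer.Rank1Residual Summit.BirchSwinnertonDyer.Rank1Residual.Additive
  Summit.BirchSwinnertonDyer.BirchSwinnertonDyer.Theses.TeichmullerTwistDescent
  Summit.BirchSwinnertonDyer.BirchSwinnertonDyer.Theorems CongruenceSubgroup

namespace Summit.BirchSwinnertonDyer.BirchSwinnertonDyer.Theorems.TeichmullerTwistDescent

/-! ### §1 No local `p`-torsion on the class, by transport; §2 the twist transfer and «at most once» without `hDD` -/

/-- **No member of the class has a `ℚ_p`-rational point of order `p`, WITHOUT Dokchitser–Dokchitser**: for `W/ℚ`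
globally minimal, additive at `p ≥ 5` with `E[p]` irreducible and `4 ≤ ord_p Δ_min(W)`, every `W' ∼ W` has
`W'(ℚ_p)[p] = 0` — a point of order `p` on `W'` transports to `W` along a cyclic `ℚ`-isogeny of degree prime
to `p` (`TorsTwist.exists_prime_smul_eq_zero_of_isIsogenous`), where Mazur's Step 1 forbids it
(`eq_zero_of_prime_nsmul_eq_zero_of_addv_of_four_le`). Compare `forall_member_noPTorsion_of_four_le` (via `hDD`).
[cite: Mazur1977, Ch. III §5, Step 1, p. 158] [cite: SilvermanAEC2009, III.4 and III.6.2] -/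
theorem forall_member_noPTorsion_of_four_le_of_irr (W : WeierstrassCurve ℚ) [W.IsElliptic]
    [W.IsGloballyMinimal] (p : ℕ) [hp : Fact p.Prime] (hp5 : 5 ≤ p) (hadd : Addv W p) (hirr : Irr W p)
    (hv : 4 ≤ padicValInt p W.minimalDiscriminantInt)
    (W' : WeierstrassCurve ℚ) [W'.IsElliptic] [W'.IsGloballyMinimal] (hiso : IsIsogenous W W')
    (P : (W'.baseChange ℚ_[p]).toAffine.Point) (hP : p • P = 0) : P = 0 := by
  by_contra hP0
  obtain ⟨P₀, hP₀0, hP₀⟩ :=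
    TorsTwist.exists_prime_smul_eq_zero_of_isIsogenous hirr hiso hP0 (by rw [natCast_zsmul]; exact hP)
  exact hP₀0 (eq_zero_of_prime_nsmul_eq_zero_of_addv_of_four_le W p hp5 hadd hv
    (by rw [← natCast_zsmul]; exact hP₀))

/-- **The `p*`-twist transfer at an unstarred additive `p ∈ {5, 7}`, GRANTED modularity and F″ only** (§3's
`dvd_pStar_mul_of_kato57_of_lt_six` with `hDD` removed by `forall_member_noPTorsion_of_four_le_of_irr`):
`c(D) ∣ p*·c'` with `p ∤ c'`. [cite: Stevens1989, Lemmas (5.2), (5.4)] [cite: Pal2012, Prop. 2.5]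
[cite: Kato2004Asterisque, Thm. 9.7 (p. 189)] [cite: KostersPannekoek2017, Thm. 1 and Cor. 2] -/
theorem dvd_pStar_mul_of_katoNeron_of_lt_six (hnf : exists_isNewformOf)
    (hK : kato_neron_isIntegral_twistedSymbolSum_of_additive_five_le)
    (W : WeierstrassCurve ℚ) [W.IsElliptic] [W.IsGloballyMinimal] (p : ℕ) [hp : Fact p.Prime]
    [NeZero (W.conductorNorm ℤ)] (D : ModularParametrizationData W (W.conductorNorm ℤ))
    (hp57 : p = 5 ∨ p = 7) (hadd : Addv W p) (hirr : Irr W p)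
    (h6 : padicValInt p W.minimalDiscriminantInt < 6)
    (hlat : ∀ z ∈ D.L.lattice, ∃ w ∈ periodLattice D.f, z = D.c * w) :
    ∃ c' : ℤ, ¬ (p : ℤ) ∣ c' ∧ D.c ∣ ((-1 : ℤ) ^ (p / 2) * p) * c' := by
  have hpP : p.Prime := hp.out
  have hp5 : 5 ≤ p := by rcases hp57 with rfl | rfl <;> norm_num
  have hp2 : p ≠ 2 := by omega
  set d : ℤ := (-1 : ℤ) ^ (p / 2) * p with hd
  have hdZ : d ≠ 0 := mul_ne_zero (pow_ne_zero _ (by norm_num)) (by exact_mod_cast hpP.ne_zero)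
  have hd0 : (d : ℚ) ≠ 0 := by exact_mod_cast hdZ
  have hj : 0 ≤ padicValRat p W.j :=
    ManinFrameResidueProperRTameTwist.padicValRat_j_nonneg_of_addv_of_forall_kodairaSymbolAt_ne_Istar W hp2
      hadd (placeOf p) (natGenerator_placeOf p) (forall_ne_Istar_of_padicValInt_lt_six W p hp5 hadd h6)
  obtain ⟨A, hEA, hMA, CA, hCA⟩ := exists_minimal_twist_pStar p W
  haveI := hEA
  haveI := hMA
  haveI : NeZero (A.conductorNorm ℤ) := ⟨(A.conductorNorm_pos_holds).ne'⟩
  have hCA' : CA • W.quadraticTwist (d : ℚ) = A := by rw [hd, (pStar_intCast p).1]; exact hCA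
  obtain ⟨haddA, -, h6A⟩ := addv_of_twist_pStar p hp2 W A hj h6 CA hCA
  have hv' : CA⁻¹ • A = W.quadraticTwist (d : ℚ) := by rw [← hCA', inv_smul_smul]
  have hirrA : Irr A p :=
    BurungaleSkinnerTianWan2024.hasIrreducibleModPGaloisRep_of_smul_eq_quadraticTwist W A p hd0 hv' hirr
  -- the partner datum on `A` with `p ∤ c'`: F″ on the class of `A` (torsion-free by TRANSPORT), moved to `A`
  obtain ⟨W₀, hE₀, hM₀, D₀, hisoA, hc₀⟩ :=
    ManinFrameResidueProperRTameTwist.exists_member_not_dvd_c_of_tameTwist57 hK hnf A hp57 haddA hirrA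
      (fun W' _ _ hiso P hP ↦ forall_member_noPTorsion_of_four_le_of_irr A p hp5 haddA hirrA (by omega) W' hiso P hP)
  haveI := hE₀
  haveI := hM₀
  obtain ⟨D', hc'⟩ :=
    ManinFrameTransport.exists_modularParametrizationData_not_dvd_of_partner A hpP hirrA hisoA D₀ hc₀
  have hNA : A.conductorNorm ℤ = W.conductorNorm ℤ := conductorNorm_eq_of_twist_pStar p hp5 W A hadd haddA CA hCA
  have hN : A.conductorNorm ℤ ∣ W.conductorNorm ℤ := hNA ▸ dvd_rfl
  have hpN : p ^ 2 ∣ W.conductorNorm ℤ := sq_dvd_conductorNorm_of_not_good_of_not_mult hadd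
  set χ := (quadraticChar (ZMod p)).ringHomComp (Int.castRingHom ℂ) with hχ
  have hχq := isQuadratic_quadraticChar_ringHomComp p
  have hχp := isPrimitive_quadraticChar_ringHomComp p hp2
  have hG := gaussSum_quadraticChar_ringHomComp_sq p hp2
  have haddO : W.HasAdditiveReductionAt ((primesEquiv (R := 𝓞 ℚ)).symm ⟨p, hpP⟩) :=
    Additive.hasAdditiveReductionAt_of_addv W p hadd
  have haddAO : A.HasAdditiveReductionAt ((primesEquiv (R := 𝓞 ℚ)).symm ⟨p, hpP⟩) :=
    Additive.hasAdditiveReductionAt_of_addv A p haddA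
  have hvO : (primesEquiv ((primesEquiv (R := 𝓞 ℚ)).symm ⟨p, hpP⟩) : ℕ) = p :=
    Additive.primesEquiv_symm_apply_coe p
  have hcoef : ∀ n : ℕ, cuspCoeff D.f n = χ n * cuspCoeff D'.f n := by
    intro n
    rw [D.isNewformOf.2 n, D'.isNewformOf.2 n, hχ, quadraticChar_ringHomComp_apply_natCast p n]
    by_cases hpn : p ∣ n
    · rw [W.LFunction_apply_eq_zero_of_hasAdditiveReductionAt hvO haddO hpn,
        A.LFunction_apply_eq_zero_of_hasAdditiveReductionAt hvO haddAO hpn]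
      push_cast
      ring
    · haveI : (W.quadraticTwist (d : ℚ)).IsElliptic := W.isElliptic_quadraticTwist hd0
      rw [← hCA', LFunction_smul, W.LFunction_quadraticTwist_pStar_apply hp2 hpn]
      have hne : ((n : ℤ) : ZMod p) ≠ 0 := by
        rw [Int.cast_natCast, Ne, ZMod.natCast_eq_zero_iff]
        exact hpn
      push_cast
      rcases legendreSym.eq_one_or_neg_one p hne with h1 | h1
      · rw [show (legendreSym p (n : ℤ)) = legendreSym p n from rfl, h1]; push_cast; ring
      · rw [show (legendreSym p (n : ℤ)) = legendreSym p n from rfl, h1]; push_cast; ring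
  have hLA : ∀ z : ℂ, z ∈ D'.L.lattice ↔
      gaussSum χ (ZMod.stdAddChar (N := p)) * z ∈ D.L.lattice := fun z ↦
    neronLattice_quadraticTwist_pStar_of_lt_six W D.isNeronLattice hp2 h6 A ⟨CA, hCA'⟩ D'.isNeronLattice
      hG z
  exact ⟨D'.c, hc', dvd_mul_of_charTwist_gamma0_of_sq D' D hlat hχq hχp hN hpN hcoef hG hLA⟩

/-- **«At most once» GRANTED modularity and F″ ONLY** (§4's `not_sq_dvd_c_of_kato` with Dokchitser–Dokchitser
removed): for `W/ℚ` globally minimal, additive at `p ≥ 5` with `E[p]` irreducible, `D` lattice-optimal at any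
level: `p² ∤ c(D)`. [cite: EdixhovenManin1991, Thm. 3 (second sentence)]
[cite: Kato2004Asterisque, (8.1.3) (p. 180), Thm. 9.7 (p. 189)] [cite: KostersPannekoek2017, Thm. 1 and Cor. 2] -/
theorem not_sq_dvd_c_of_katoNeron (hnf : exists_isNewformOf)
    (hK : kato_neron_isIntegral_twistedSymbolSum_of_additive_five_le)
    (W : WeierstrassCurve ℚ) [W.IsElliptic] [W.IsGloballyMinimal] (p : ℕ) [hp : Fact p.Prime]
    {N : ℕ} [NeZero N] (D : ModularParametrizationData W N)
    (hp5 : 5 ≤ p) (hadd : Addv W p) (hirr : Irr W p)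
    (hlat : ∀ z ∈ D.L.lattice, ∃ w ∈ periodLattice D.f, z = D.c * w) :
    ¬ (p : ℤ) ^ 2 ∣ D.c := by
  have hpP : p.Prime := hp.out
  have hN : N = W.conductorNorm ℤ :=
    IsNewformOf.level_eq_conductorNorm_of_exists_isNewformOf hnf D.isNewformOf
  subst hN
  have hpN : p ^ 2 ∣ W.conductorNorm ℤ := sq_dvd_conductorNorm_of_not_good_of_not_mult hadd
  have ha := lFunction_eq_one_or_neg_one_of_exactly_dvd_conductorNorm W
  have hsq_of_not : ¬ (p : ℤ) ∣ D.c → ¬ (p : ℤ) ^ 2 ∣ D.c := fun h h2 ↦ h ((dvd_pow_self _ two_ne_zero).trans h2)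
  rcases Nat.lt_or_ge 7 p with h7 | h7
  · exact hsq_of_not (ManinFrameResidueProperRTameTwist.not_dvd_c_of_tameTwistL
      (Cruxes.StarredOptimalManinUnitFiveSeven.KatoLever.kato_neron_of_five_le hK) W D hlat h7 hadd hirr hpN ha)
  · have hp57 : p = 5 ∨ p = 7 := by
      interval_cases p <;>
        first | exact Or.inl rfl | exact Or.inr rfl | exact absurd hpP (by decide)
    by_cases h6 : padicValInt p W.minimalDiscriminantInt < 6
    · obtain ⟨c', hc', hdvd⟩ := dvd_pStar_mul_of_katoNeron_of_lt_six hnf hK W p D hp57 hadd hirr h6 hlat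
      intro h2
      apply hc'
      have h3 : (p : ℤ) * p ∣ ((-1 : ℤ) ^ (p / 2) * p) * c' := by rw [← sq]; exact h2.trans hdvd
      rcases (pStar_intCast p).2 with hd | hd <;> rw [hd] at h3
      · exact (mul_dvd_mul_iff_left (by exact_mod_cast hpP.ne_zero : (p : ℤ) ≠ 0)).mp h3
      · rw [neg_mul, dvd_neg] at h3
        exact (mul_dvd_mul_iff_left (by exact_mod_cast hpP.ne_zero : (p : ℤ) ≠ 0)).mp h3
    · have hPT : ∀ P : (W.baseChange ℚ_[p]).toAffine.Point, p • P = 0 → P = 0 := fun P hP ↦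
        eq_zero_of_prime_nsmul_eq_zero_of_addv_of_four_le W p hp5 hadd (by omega) hP
      exact hsq_of_not (cell57_of_kato57_of_noPTorsion hK W p D hp57 hadd hirr hPT hlat)

/-- **`ord_p c(D) ≤ 1` GRANTED modularity and F″ ONLY.** [cite: EdixhovenManin1991, Thm. 3 (second sentence)]
[cite: Kato2004Asterisque, Thm. 9.7 (p. 189)] -/
theorem padicValInt_c_le_one_of_katoNeron (hnf : exists_isNewformOf)
    (hK : kato_neron_isIntegral_twistedSymbolSum_of_additive_five_le)
    (W : WeierstrassCurve ℚ) [W.IsElliptic] [W.IsGloballyMinimal] (p : ℕ) [hp : Fact p.Prime]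
    {N : ℕ} [NeZero N] (D : ModularParametrizationData W N)
    (hp5 : 5 ≤ p) (hadd : Addv W p) (hirr : Irr W p)
    (hlat : ∀ z ∈ D.L.lattice, ∃ w ∈ periodLattice D.f, z = D.c * w) :
    padicValInt p D.c ≤ 1 := by
  by_contra h
  have h2 : (p : ℤ) ^ 2 ∣ D.c :=
    (pow_dvd_pow (p : ℤ) (by omega : 2 ≤ padicValInt p D.c)).trans (padicValInt_dvd D.c)
  exact not_sq_dvd_c_of_katoNeron hnf hK W p D hp5 hadd hirr hlat h2

/-- **«At most once» from the route's REGISTERED PUB bundles** `KatoNeronAndCremonaFacts` (stmt-23789; F″) and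
`PublishedInputsAdditiveKoly` (stmt-20137; modularity): under their conjunction, `ord_p c(D) ≤ 1` for every
lattice-optimal datum at an additive `p ≥ 5` with `E[p]` irreducible — in particular on CORNER (23883) and LOW
(23884). BSD is not proved by this. [cite: EdixhovenManin1991, Thm. 3 (second sentence)] -/
theorem padicValInt_c_le_one_of_pubBundles (hKC : KatoNeronAndCremonaFacts) (hP : PublishedInputsAdditiveKoly)
    (W : WeierstrassCurve ℚ) [W.IsElliptic] [W.IsGloballyMinimal] (p : ℕ) [Fact p.Prime]
    {N : ℕ} [NeZero N] (D : ModularParametrizationData W N)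
    (hp5 : 5 ≤ p) (hadd : Addv W p) (hirr : Irr W p)
    (hlat : ∀ z ∈ D.L.lattice, ∃ w ∈ periodLattice D.f, z = D.c * w) :
    padicValInt p D.c ≤ 1 :=
  padicValInt_c_le_one_of_katoNeron hP.2.2.2.2.2.1 hKC.1 W p D hp5 hadd hirr hlat

end Summit.BirchSwinnertonDyer.BirchSwinnertonDyer.Theorems.TeichmullerTwistDescent

end
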